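import Literature.Probability.FitznerVanDerHofstad2017.Stage1TailsRec
import Literature.Probability.FitznerVanDerHofstad2017.Stage1EvalRem

/-!
# The `N ≥ 4` tails of cells 41–43 over the SLOTTED stage-1 recipe (`Stage1Cells.Rem`, slots `ρ : Fin 10 → T`)

Literature layer, sorry-free, ADDITIVE companion of `Stage1Tails` / `Stage1TailsEval` / `Stage1TailsRec` (untouched)
and of `Stage1CellsRem` / `Stage1FrameRem` / `Stage1EvalRem`; build `lace`, seat lean1 (gen 30), node STAGE1-TAILSREM
(the tails prerequisite of TAILS-D10 in `carver/g35/D10-KERNEL-CENSUS.md` §2).  GENERIC in the dimension, the table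
orders and the slots: no numeral, no table, no dimension, no verdict, nothing here is a cited fact or a certificate.

`Stage1CellsRem` re-derives the stage-1 cells with the ten remainder reads of D55 rows 1–10 as SLOTS `ρ`;
`Stage1FrameRem` carries them through the typed frame (`Data.evRm ρ`, `Data.inpRm ρ` = the tail-free cell-44 record
of the cells of record at the slots) and `Stage1EvalRem` is its rational mirror (`DataQ.evRm`, `DataQ.inpRm`, cast
lemmas `Data.evRm_ratCast`, `Data.inpRm_ratCast`).  The `N ≥ 4` tails of cells 41–43 (`Stage1Tails`: the tail TABLES
`Tail.*`, the readings `Reading.series` / `Reading.closed S S̄`, the Neumann certificates, the rational machinery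
`IngrQ`, `totalQ`, `total_cast`, `cert_cast`) were so far bound to the coded cells (`Stage1Tails`) and to the cells
of record at the PRINTED reads (`Stage1Tails.Rec`, over `Data.inpRec`).  This module binds them over the slotted
recipe, definition by definition VERBATIM from `Stage1Tails` (section `Frame`) and `Stage1TailsEval` (section `Frame`)
— same names inside the namespace `Stage1Tails.Rem`, each taking the slots `ρ` as an extra explicit first argument —
with exactly these substitutions: every ingredient cell `X P` ↦ `Stage1Cells.Rem.X P ρ` (`h^S`, `h^{II}`, `H₂`, `H₃`,
`h^E`, `C₁`, `C₂`, `C₁.B̄ + B.C₂`, `B`, `B̄`, `P^S`, `P^ι`, `ĀιNonRep`, `P^E`, `AιNonRep`); cell evaluation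
`Data.ev` ↦ `Data.evRm ρ`, `DataQ.ev` ↦ `DataQ.evRm · ρ`; the tail-free record `Data.inp` ↦ `Data.inpRm ρ`,
`DataQ.inpR` ↦ `DataQ.inpRm · ρ`; the cast lemmas `Data.ev_ratCast` ↦ `Data.evRm_ratCast`, `Data.inp_ratCast` ↦
`Data.inpRm_ratCast`.  Proofs are the originals verbatim (they are insensitive to which cells the ingredients are and
to how they are evaluated).

Main content: `Rem.inpFull ρ D y s` = cell 44 WITH TAILS over the slotted recipe; `Rem.inp_dom_inpFull_rem`
(`D.inpRm ρ ≤ Rem.inpFull ρ`), `Rem.inpFull_dom_inpMaj_rem` (≤ the closed-form majorant under the two exact-inverse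
Neumann certificates), the rational majorant record `Rem.inpMajQ E P ρ`, the cast lemma `Rem.inpMaj_ratCast_rem` and
the kernel form `Rem.inpFull_dom_of_ratModel_rem`; and LITERAL REPRODUCTION at the record reads: at `ρ := printSlots P`
every object of this file IS the corresponding object of `Stage1Tails.Rec` (`ingr_print`, `tailVal_print`,
`inpT_print`, `inpFull_print`, `inpMaj_print`, `ingrQ_print`, `tailValQ_print`, `inpMajQ_print`), by the `_print`
identities of `Stage1CellsRem` / `Stage1FrameRem` / `Stage1EvalRem`.  Generator and audit trail: `lean1-g30/tailsrem/
gen_tails_rem.py` (from lean2-g12 `gen_tails_rec.py`).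
-/

noncomputable section

namespace Literature.Probability.FitznerVanDerHofstad2017
namespace Stage1Tails.Rem

open Stage1Cells NoGoFrame BetaMap

/-! ## The tails over the slotted typed frame -/

section Frame

variable {ν : Type*}

/-- (slotted recipe: re-bound over `Stage1Cells.Rem · ρ`) `h^S.AiotaNonRepᵀ` (cell 42; cells 38–40 use `Aiota` here, cell 42 prints `AiotaNonRep`). [cite: FitznerVanDerHofstad2017, notebook Percolation.nb cell 42 (transcript l.1161–1164)] -/
def hSAtNR (P : Params) (ρ : Fin 10 → T) : Vec := vecMul (Stage1Cells.Rem.hS P ρ) (tr (Stage1Cells.Rem.AiotaNR P ρ))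

/-- (slotted recipe: re-bound over `Stage1Cells.Rem · ρ`) `H₃.P^E + AiotaNonRep.h^E` (cell 42). [cite: FitznerVanDerHofstad2017, notebook Percolation.nb cell 42 (transcript l.1161–1169)] -/
def H3PEAhE (P : Params) (ρ : Fin 10 → T) : Vec := vadd (Stage1Cells.mulVec (Stage1Cells.Rem.H3 P ρ) (Stage1Cells.Rem.PE P ρ)) (Stage1Cells.mulVec (Stage1Cells.Rem.AiotaNR P ρ) (Stage1Cells.Rem.hE P ρ))

/-- (slotted recipe: re-bound over `Stage1Cells.Rem · ρ`) `H₂.P^E + AiotaNonRep.h^E` (cell 42). [cite: FitznerVanDerHofstad2017, notebook Percolation.nb cell 42 (transcript l.1167–1170)] -/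
def H2PEAhE (P : Params) (ρ : Fin 10 → T) : Vec := vadd (Stage1Cells.mulVec (Stage1Cells.Rem.H2 P ρ) (Stage1Cells.Rem.PE P ρ)) (Stage1Cells.mulVec (Stage1Cells.Rem.AiotaNR P ρ) (Stage1Cells.Rem.hE P ρ))

/-- (slotted recipe: re-bound over `Stage1Cells.Rem · ρ`) `C₂.B̄ + B.C₁` (cell 42). [cite: FitznerVanDerHofstad2017, notebook Percolation.nb cell 42 (transcript l.1166–1169)] -/
def C2BbarBC1 (P : Params) (ρ : Fin 10 → T) : Mat := madd (matMul (Stage1Cells.Rem.C2 P ρ) (Stage1Cells.Rem.Bbar P ρ)) (matMul (Stage1Cells.Rem.B P ρ) (Stage1Cells.Rem.C1 P ρ))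

/-- (slotted recipe) a typed vector of cells as a real vector at `(s, y)`, cells evaluated by `Data.evRm ρ`. [cite: FitznerVanDerHofstad2017, notebook Percolation.nb cells 41–44 (transcript l.1131–1237)] -/
def evV (ρ : Fin 10 → T) (D : Data ν) (s : Pt) (y : State) (v : Vec) : Fin 3 → ℝ := fun a => D.evRm ρ s y (v a)

/-- (slotted recipe) a typed matrix of cells as a real matrix at `(s, y)`, cells evaluated by `Data.evRm ρ`. [cite: FitznerVanDerHofstad2017, notebook Percolation.nb cells 41–44 (transcript l.1131–1237)] -/
def evM (ρ : Fin 10 → T) (D : Data ν) (s : Pt) (y : State) (Mx : Mat) : Matrix (Fin 3) (Fin 3) ℝ :=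
  Matrix.of fun a b => D.evRm ρ s y (Mx a b)

/-- (slotted recipe: re-bound over `Stage1Cells.Rem · ρ`) The ingredients of cells 41–42 over the typed frame `D` at `(s, y)`. [cite: FitznerVanDerHofstad2017, notebook Percolation.nb cells 30–31, 41–42 (transcript l.840–888, l.1131–1175)] -/
def ingr (ρ : Fin 10 → T) (D : Data ν) (s : Pt) (y : State) : Ingr (Fin 3) where
  u := fun
    | .PS => evV ρ D s y (Stage1Cells.Rem.PS D.P ρ)
    | .Piota => evV ρ D s y (Stage1Cells.Rem.Piota D.P ρ)
    | .hSAtNR => evV ρ D s y (hSAtNR D.P ρ)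
    | .hII => evV ρ D s y (Stage1Cells.Rem.hII D.P ρ)
  m := fun
    | .AbarNR => evM ρ D s y (Stage1Cells.Rem.AiotabarNR D.P ρ)
    | .one => 1
    | .C1 => evM ρ D s y (Stage1Cells.Rem.C1 D.P ρ)
    | .C2 => evM ρ D s y (Stage1Cells.Rem.C2 D.P ρ)
    | .C1BbBC2 => evM ρ D s y (Stage1Cells.Rem.C1BbarBC2 D.P ρ)
    | .C2BbBC1 => evM ρ D s y (C2BbarBC1 D.P ρ)
  w := fun
    | .PE => evV ρ D s y (Stage1Cells.Rem.PE D.P ρ)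
    | .H3PEAhE => evV ρ D s y (H3PEAhE D.P ρ)
    | .H2PEAhE => evV ρ D s y (H2PEAhE D.P ρ)
  B := evM ρ D s y (Stage1Cells.Rem.B D.P ρ)
  Bb := evM ρ D s y (Stage1Cells.Rem.Bbar D.P ρ)

/-- (slotted recipe: re-bound over `Stage1Cells.Rem · ρ`) where every cell is `≥ 0` the ingredients are `≥ 0`. [cite: FitznerVanDerHofstad2017, notebook Percolation.nb cells 41–44 (transcript l.1131–1237)] -/
theorem ingr_nonneg_rem (ρ : Fin 10 → T) {D : Data ν} {s : Pt} {y : State} (hev : ∀ e, 0 ≤ D.evRm ρ s y e) : (ingr ρ D s y).Nonneg where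
  u t i := by cases t <;> exact hev _
  m t i j := by
    cases t
    case one => exact one_apply_nonneg i j
    all_goals exact hev _
  w t i := by cases t <;> exact hev _
  B i j := hev _
  Bb i j := hev _

/-- (slotted recipe: re-bound over `Stage1Cells.Rem · ρ`) the value at `(s, y)` of a cell-41/42 table under the reading `Φ`. [cite: FitznerVanDerHofstad2017, notebook Percolation.nb cells 41–44 (transcript l.1131–1237)] -/
def tailVal (ρ : Fin 10 → T) (Φ : Reading (Fin 3)) (D : Data ν) (y : State) (s : Pt) (l : List Piece) : ℝ :=
  total Φ (ingr ρ D s y) l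

/-- (slotted recipe: re-bound over `Stage1Cells.Rem · ρ`, tail-free record `Data.inpRm ρ`) Cell 44 with the `N ≥ 4` tails of cells 41–43 READ BY `Φ` added to the tail-free record `Data.inpRm ρ` (`T″₀`):
`EvenTail = Bound[·,2,·] + tail`, `OddTail = Bound[·,3,·] + tail`, and cell 43's sums `Even = 0 + EvenTail`,
`Odd = 1 + OddTail`, `Absolut = Odd + Even` accordingly (twenty-two fields move; the rest is `Data.inpRm ρ`).
[cite: FitznerVanDerHofstad2017, notebook Percolation.nb cells 43–44 (transcript l.1182–1202, l.1214–1237)] -/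
def inpT (ρ : Fin 10 → T) (Φ : Pt → Reading (Fin 3)) (D : Data ν) (y : State) (s : Pt) : Inputs :=
  { D.inpRm ρ y s with
    xiAbs := (D.inpRm ρ y s).xiAbs + (tailVal ρ (Φ s) D y s Tail.xiOdd + tailVal ρ (Φ s) D y s Tail.xiEven)
    xiOdd := (D.inpRm ρ y s).xiOdd + tailVal ρ (Φ s) D y s Tail.xiOdd
    xiEven := (D.inpRm ρ y s).xiEven + tailVal ρ (Φ s) D y s Tail.xiEven
    xiEvenTail := (D.inpRm ρ y s).xiEvenTail + tailVal ρ (Φ s) D y s Tail.xiEven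
    xiOddTail := (D.inpRm ρ y s).xiOddTail + tailVal ρ (Φ s) D y s Tail.xiOdd
    xiDeltaAbs := (D.inpRm ρ y s).xiDeltaAbs
      + (tailVal ρ (Φ s) D y s Tail.xiOddDelta + tailVal ρ (Φ s) D y s Tail.xiEvenDelta)
    xiOddDelta := (D.inpRm ρ y s).xiOddDelta + tailVal ρ (Φ s) D y s Tail.xiOddDelta
    xiEvenDelta := (D.inpRm ρ y s).xiEvenDelta + tailVal ρ (Φ s) D y s Tail.xiEvenDelta
    xiOddTailDelta := (D.inpRm ρ y s).xiOddTailDelta + tailVal ρ (Φ s) D y s Tail.xiOddDelta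
    xiEvenTailDelta := (D.inpRm ρ y s).xiEvenTailDelta + tailVal ρ (Φ s) D y s Tail.xiEvenDelta
    xiIotaAbs := (D.inpRm ρ y s).xiIotaAbs + (tailVal ρ (Φ s) D y s Tail.xiIotaOdd + tailVal ρ (Φ s) D y s Tail.xiIotaEven)
    xiIotaOdd := (D.inpRm ρ y s).xiIotaOdd + tailVal ρ (Φ s) D y s Tail.xiIotaOdd
    xiIotaEven := (D.inpRm ρ y s).xiIotaEven + tailVal ρ (Φ s) D y s Tail.xiIotaEven
    xiIotaEvenTail := (D.inpRm ρ y s).xiIotaEvenTail + tailVal ρ (Φ s) D y s Tail.xiIotaEven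
    xiIotaDeltaEi := (D.inpRm ρ y s).xiIotaDeltaEi
      + (tailVal ρ (Φ s) D y s Tail.xiIotaOddDeltaEi + tailVal ρ (Φ s) D y s Tail.xiIotaEvenDeltaEi)
    xiIotaOddDeltaEi := (D.inpRm ρ y s).xiIotaOddDeltaEi + tailVal ρ (Φ s) D y s Tail.xiIotaOddDeltaEi
    xiIotaEvenDeltaEi := (D.inpRm ρ y s).xiIotaEvenDeltaEi + tailVal ρ (Φ s) D y s Tail.xiIotaEvenDeltaEi
    xiIotaEvenTailDeltaEi := (D.inpRm ρ y s).xiIotaEvenTailDeltaEi + tailVal ρ (Φ s) D y s Tail.xiIotaEvenDeltaEi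
    xiIotaDeltaZero := (D.inpRm ρ y s).xiIotaDeltaZero
      + (tailVal ρ (Φ s) D y s Tail.xiIotaOddDeltaZero + tailVal ρ (Φ s) D y s Tail.xiIotaEvenDeltaZero)
    xiIotaOddDeltaZero := (D.inpRm ρ y s).xiIotaOddDeltaZero + tailVal ρ (Φ s) D y s Tail.xiIotaOddDeltaZero
    xiIotaEvenDeltaZero := (D.inpRm ρ y s).xiIotaEvenDeltaZero + tailVal ρ (Φ s) D y s Tail.xiIotaEvenDeltaZero
    xiIotaEvenTailDeltaZero := (D.inpRm ρ y s).xiIotaEvenTailDeltaZero + tailVal ρ (Φ s) D y s Tail.xiIotaEvenDeltaZero }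

/-- (slotted recipe: re-bound over `Stage1Cells.Rem · ρ`) CELL 44 AS THE NOTEBOOK ITERATES IT: the App. D input record WITH the `N ≥ 4` tails (series reading).
[cite: FitznerVanDerHofstad2017, notebook Percolation.nb cells 41–44 (transcript l.1131–1237)] -/
def inpFull (ρ : Fin 10 → T) (D : Data ν) (y : State) (s : Pt) : Inputs := inpT ρ (fun _ => Reading.series) D y s

/-- (slotted recipe: re-bound over `Stage1Cells.Rem · ρ`) The closed-form MAJORANT record at candidate inverses `S s` of `1 − B(s)²` and `S̄ s` of `1 − B̄(s)²`.
[cite: FitznerVanDerHofstad2017, notebook Percolation.nb cells 41–44 (transcript l.1131–1237)] -/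
def inpMaj (ρ : Fin 10 → T) (S Sb : Pt → Matrix (Fin 3) (Fin 3) ℝ) (D : Data ν) (y : State) (s : Pt) : Inputs :=
  inpT ρ (fun s => Reading.closed (S s) (Sb s)) D y s

variable (ρ : Fin 10 → T) {D : Data ν} {y : State} {s : Pt}

/-- (slotted recipe: re-bound over `Stage1Cells.Rem · ρ`) `Data.inpRm ρ ≤ inpT Φ` for a non-negative reading. [cite: FitznerVanDerHofstad2017, notebook Percolation.nb cells 41–44 (transcript l.1131–1237)] -/
theorem inp_dom_inpT_rem {Φ : Pt → Reading (Fin 3)} (hΦ : (Φ s).NonnegAt (ingr ρ D s y).B (ingr ρ D s y).Bb)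
    (hI : (ingr ρ D s y).Nonneg) : (D.inpRm ρ y s).Dom (inpT ρ Φ D y s) where
  mu := le_rfl
  muMin := le_rfl
  mubOverMu := le_rfl
  mub := le_rfl
  xiAlphaOneMinusZeroAtZero := le_rfl
  xiAlphaZeroMinusOneAtZero := le_rfl
  xiAlphaOneMinusZeroAtEi := le_rfl
  xiAlphaZeroMinusOneAtEi := le_rfl
  xiIotaAlphaIAtEi := le_rfl
  xiIotaAlphaIIAtZero := le_rfl
  xiIotaAlphaISumAroundEi := le_rfl
  xiIotaAlphaIISumAroundZero := le_rfl
  psiAlphaIOneMinusZeroAroundEi := le_rfl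
  psiAlphaIIZeroMinusOneAroundZero := le_rfl
  psiAlphaIZeroMinusOneAroundEi := le_rfl
  psiAlphaIIOneMinusZeroAroundZero := le_rfl
  piAlpha := le_rfl
  piAlphaLower := le_rfl
  piOneLower := le_rfl
  psiZeroLower := le_rfl
  xiAbs := le_add_of_nonneg_right (add_nonneg (total_nonneg hΦ hI _) (total_nonneg hΦ hI _))
  xiOdd := le_add_of_nonneg_right (total_nonneg hΦ hI _)
  xiEven := le_add_of_nonneg_right (total_nonneg hΦ hI _)
  xiEvenTail := le_add_of_nonneg_right (total_nonneg hΦ hI _)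
  xiOddTail := le_add_of_nonneg_right (total_nonneg hΦ hI _)
  xiR0 := le_rfl
  xiR1 := le_rfl
  xiR0Delta := le_rfl
  xiR1Delta := le_rfl
  xiDeltaAbs := le_add_of_nonneg_right (add_nonneg (total_nonneg hΦ hI _) (total_nonneg hΦ hI _))
  xiOddDelta := le_add_of_nonneg_right (total_nonneg hΦ hI _)
  xiEvenDelta := le_add_of_nonneg_right (total_nonneg hΦ hI _)
  xiOddTailDelta := le_add_of_nonneg_right (total_nonneg hΦ hI _)
  xiEvenTailDelta := le_add_of_nonneg_right (total_nonneg hΦ hI _)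
  psiRI0 := le_rfl
  psiRI1 := le_rfl
  psiRII0 := le_rfl
  psiRII1 := le_rfl
  psiRI0Delta := le_rfl
  psiRI1Delta := le_rfl
  psiRII0Delta := le_rfl
  psiRII1Delta := le_rfl
  piR0 := le_rfl
  piR0DeltaEiEk := le_rfl
  xiIotaAbs := le_add_of_nonneg_right (add_nonneg (total_nonneg hΦ hI _) (total_nonneg hΦ hI _))
  xiIotaOdd := le_add_of_nonneg_right (total_nonneg hΦ hI _)
  xiIotaEven := le_add_of_nonneg_right (total_nonneg hΦ hI _)
  xiIotaEvenTail := le_add_of_nonneg_right (total_nonneg hΦ hI _)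
  xiIotaRI0 := le_rfl
  xiIotaRII0 := le_rfl
  xiIotaDeltaEi := le_add_of_nonneg_right (add_nonneg (total_nonneg hΦ hI _) (total_nonneg hΦ hI _))
  xiIotaOddDeltaEi := le_add_of_nonneg_right (total_nonneg hΦ hI _)
  xiIotaEvenDeltaEi := le_add_of_nonneg_right (total_nonneg hΦ hI _)
  xiIotaEvenTailDeltaEi := le_add_of_nonneg_right (total_nonneg hΦ hI _)
  xiIotaDeltaZero := le_add_of_nonneg_right (add_nonneg (total_nonneg hΦ hI _) (total_nonneg hΦ hI _))
  xiIotaOddDeltaZero := le_add_of_nonneg_right (total_nonneg hΦ hI _)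
  xiIotaEvenDeltaZero := le_add_of_nonneg_right (total_nonneg hΦ hI _)
  xiIotaEvenTailDeltaZero := le_add_of_nonneg_right (total_nonneg hΦ hI _)
  xiIotaRI0DeltaEi := le_rfl
  xiIotaRII0DeltaZero := le_rfl

/-- (slotted recipe: re-bound over `Stage1Cells.Rem · ρ`) `inpT Φ ≤ inpT Ψ` for comparable readings. [cite: FitznerVanDerHofstad2017, notebook Percolation.nb cells 41–44 (transcript l.1131–1237)] -/
theorem inpT_dom_inpT_rem {Φ Ψ : Pt → Reading (Fin 3)} (h : (Φ s).LEAt (Ψ s) (ingr ρ D s y).B (ingr ρ D s y).Bb)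
    (hI : (ingr ρ D s y).Nonneg) : (inpT ρ Φ D y s).Dom (inpT ρ Ψ D y s) where
  mu := le_rfl
  muMin := le_rfl
  mubOverMu := le_rfl
  mub := le_rfl
  xiAlphaOneMinusZeroAtZero := le_rfl
  xiAlphaZeroMinusOneAtZero := le_rfl
  xiAlphaOneMinusZeroAtEi := le_rfl
  xiAlphaZeroMinusOneAtEi := le_rfl
  xiIotaAlphaIAtEi := le_rfl
  xiIotaAlphaIIAtZero := le_rfl
  xiIotaAlphaISumAroundEi := le_rfl
  xiIotaAlphaIISumAroundZero := le_rfl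
  psiAlphaIOneMinusZeroAroundEi := le_rfl
  psiAlphaIIZeroMinusOneAroundZero := le_rfl
  psiAlphaIZeroMinusOneAroundEi := le_rfl
  psiAlphaIIOneMinusZeroAroundZero := le_rfl
  piAlpha := le_rfl
  piAlphaLower := le_rfl
  piOneLower := le_rfl
  psiZeroLower := le_rfl
  xiAbs := add_le_add le_rfl (add_le_add (total_mono h hI _) (total_mono h hI _))
  xiOdd := add_le_add le_rfl (total_mono h hI _)
  xiEven := add_le_add le_rfl (total_mono h hI _)
  xiEvenTail := add_le_add le_rfl (total_mono h hI _)
  xiOddTail := add_le_add le_rfl (total_mono h hI _)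
  xiR0 := le_rfl
  xiR1 := le_rfl
  xiR0Delta := le_rfl
  xiR1Delta := le_rfl
  xiDeltaAbs := add_le_add le_rfl (add_le_add (total_mono h hI _) (total_mono h hI _))
  xiOddDelta := add_le_add le_rfl (total_mono h hI _)
  xiEvenDelta := add_le_add le_rfl (total_mono h hI _)
  xiOddTailDelta := add_le_add le_rfl (total_mono h hI _)
  xiEvenTailDelta := add_le_add le_rfl (total_mono h hI _)
  psiRI0 := le_rfl
  psiRI1 := le_rfl
  psiRII0 := le_rfl
  psiRII1 := le_rfl
  psiRI0Delta := le_rfl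
  psiRI1Delta := le_rfl
  psiRII0Delta := le_rfl
  psiRII1Delta := le_rfl
  piR0 := le_rfl
  piR0DeltaEiEk := le_rfl
  xiIotaAbs := add_le_add le_rfl (add_le_add (total_mono h hI _) (total_mono h hI _))
  xiIotaOdd := add_le_add le_rfl (total_mono h hI _)
  xiIotaEven := add_le_add le_rfl (total_mono h hI _)
  xiIotaEvenTail := add_le_add le_rfl (total_mono h hI _)
  xiIotaRI0 := le_rfl
  xiIotaRII0 := le_rfl
  xiIotaDeltaEi := add_le_add le_rfl (add_le_add (total_mono h hI _) (total_mono h hI _))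
  xiIotaOddDeltaEi := add_le_add le_rfl (total_mono h hI _)
  xiIotaEvenDeltaEi := add_le_add le_rfl (total_mono h hI _)
  xiIotaEvenTailDeltaEi := add_le_add le_rfl (total_mono h hI _)
  xiIotaDeltaZero := add_le_add le_rfl (add_le_add (total_mono h hI _) (total_mono h hI _))
  xiIotaOddDeltaZero := add_le_add le_rfl (total_mono h hI _)
  xiIotaEvenDeltaZero := add_le_add le_rfl (total_mono h hI _)
  xiIotaEvenTailDeltaZero := add_le_add le_rfl (total_mono h hI _)
  xiIotaRI0DeltaEi := le_rfl
  xiIotaRII0DeltaZero := le_rfl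

/-- (slotted recipe: re-bound over `Stage1Cells.Rem · ρ`) `T″₀ ≤ T`: the tail-free record is below the record with tails in the information order, wherever the cells
are `≥ 0`. [cite: FitznerVanDerHofstad2017, notebook Percolation.nb cells 41–44 (transcript l.1131–1237)] -/
theorem inp_dom_inpFull_rem (hev : ∀ e, 0 ≤ D.evRm ρ s y e) : (D.inpRm ρ y s).Dom (inpFull ρ D y s) :=
  inp_dom_inpT_rem ρ (Reading.series_nonnegAt _ _) (ingr_nonneg_rem ρ hev)

/-- (slotted recipe: re-bound over `Stage1Cells.Rem · ρ`) `T ≤ T̂(S, S̄)`: under the two Neumann certificates at the point `s` the record with tails is below the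
closed-form majorant record (and the ten tail series converge there, `ser_le`). [cite: FitznerVanDerHofstad2017, notebook Percolation.nb cells 41–44 (transcript l.1131–1237)] -/
theorem inpFull_dom_inpMaj_rem (hev : ∀ e, 0 ≤ D.evRm ρ s y e) {S Sb : Pt → Matrix (Fin 3) (Fin 3) ℝ}
    (hS0 : ∀ i j, 0 ≤ S s i j) (hS : (1 - (ingr ρ D s y).B * (ingr ρ D s y).B) * S s = 1)
    (hSb0 : ∀ i j, 0 ≤ Sb s i j) (hSb : (1 - (ingr ρ D s y).Bb * (ingr ρ D s y).Bb) * Sb s = 1) :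
    (inpFull ρ D y s).Dom (inpMaj ρ S Sb D y s) :=
  inpT_dom_inpT_rem ρ
    (Reading.series_leAt_closed (ingr_nonneg_rem ρ hev).B (ingr_nonneg_rem ρ hev).Bb hS0 hS hSb0 hSb) (ingr_nonneg_rem ρ hev)

/-- (slotted recipe: re-bound over `Stage1Cells.Rem · ρ`) … hence `T″₀ ≤ T̂(S, S̄)` as well. [cite: FitznerVanDerHofstad2017, notebook Percolation.nb cells 41–44 (transcript l.1131–1237)] -/
theorem inp_dom_inpMaj_rem (hev : ∀ e, 0 ≤ D.evRm ρ s y e) {S Sb : Pt → Matrix (Fin 3) (Fin 3) ℝ}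
    (hS0 : ∀ i j, 0 ≤ S s i j) (hS : (1 - (ingr ρ D s y).B * (ingr ρ D s y).B) * S s = 1)
    (hSb0 : ∀ i j, 0 ≤ Sb s i j) (hSb : (1 - (ingr ρ D s y).Bb * (ingr ρ D s y).Bb) * Sb s = 1) :
    (D.inpRm ρ y s).Dom (inpMaj ρ S Sb D y s) :=
  (inp_dom_inpFull_rem ρ hev).trans (inpFull_dom_inpMaj_rem ρ hev hS0 hS hSb0 hSb)

end Frame

/-! ## The rational majorant record over the slotted recipe, and the cast lemmas over a modelled frame -/

section RatFrame

variable {ν : Type*}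

/-- (slotted recipe) a typed vector of cells as a rational vector at `(s, y)` over the data `E`, cells evaluated by `DataQ.evRm · ρ`. [cite: FitznerVanDerHofstad2017, notebook Percolation.nb cells 41–44 (transcript l.1131–1237)] -/
def evVQ (E : DataQ) (P : Params) (ρ : Fin 10 → T) (s : Pt) (y : StateQ) (v : Vec) : Fin 3 → ℚ := fun a => E.evRm P ρ s y (v a)

/-- (slotted recipe) a typed matrix of cells as a rational matrix at `(s, y)` over the data `E`, cells evaluated by `DataQ.evRm · ρ`. [cite: FitznerVanDerHofstad2017, notebook Percolation.nb cells 41–44 (transcript l.1131–1237)] -/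
def evMQ (E : DataQ) (P : Params) (ρ : Fin 10 → T) (s : Pt) (y : StateQ) (Mx : Mat) : Matrix (Fin 3) (Fin 3) ℚ :=
  Matrix.of fun a b => E.evRm P ρ s y (Mx a b)

/-- (slotted recipe: re-bound over `Stage1Cells.Rem · ρ`) the rational ingredients of cells 41–42 over the data `E` at `(s, y)` (mirror of `ingr`). [cite: FitznerVanDerHofstad2017, notebook Percolation.nb cells 41–44 (transcript l.1131–1237)] -/
def ingrQ (E : DataQ) (P : Params) (ρ : Fin 10 → T) (s : Pt) (y : StateQ) : IngrQ (Fin 3) where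
  u := fun
    | .PS => evVQ E P ρ s y (Stage1Cells.Rem.PS P ρ)
    | .Piota => evVQ E P ρ s y (Stage1Cells.Rem.Piota P ρ)
    | .hSAtNR => evVQ E P ρ s y (hSAtNR P ρ)
    | .hII => evVQ E P ρ s y (Stage1Cells.Rem.hII P ρ)
  m := fun
    | .AbarNR => evMQ E P ρ s y (Stage1Cells.Rem.AiotabarNR P ρ)
    | .one => 1
    | .C1 => evMQ E P ρ s y (Stage1Cells.Rem.C1 P ρ)
    | .C2 => evMQ E P ρ s y (Stage1Cells.Rem.C2 P ρ)
    | .C1BbBC2 => evMQ E P ρ s y (Stage1Cells.Rem.C1BbarBC2 P ρ)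
    | .C2BbBC1 => evMQ E P ρ s y (C2BbarBC1 P ρ)
  w := fun
    | .PE => evVQ E P ρ s y (Stage1Cells.Rem.PE P ρ)
    | .H3PEAhE => evVQ E P ρ s y (H3PEAhE P ρ)
    | .H2PEAhE => evVQ E P ρ s y (H2PEAhE P ρ)
  B := evMQ E P ρ s y (Stage1Cells.Rem.B P ρ)
  Bb := evMQ E P ρ s y (Stage1Cells.Rem.Bbar P ρ)

/-- (slotted recipe: re-bound over `Stage1Cells.Rem · ρ`) the rational value of a cell-41/42 table under the closed-form reading at `S`, `S̄`. [cite: FitznerVanDerHofstad2017, notebook Percolation.nb cells 41–44 (transcript l.1131–1237)] -/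
def tailValQ (E : DataQ) (P : Params) (ρ : Fin 10 → T) (y : StateQ) (s : Pt) (S Sb : Matrix (Fin 3) (Fin 3) ℚ)
    (l : List Piece) : ℚ :=
  totalQ S Sb (ingrQ E P ρ s y) l

/-- (slotted recipe: re-bound over `Stage1Cells.Rem · ρ`, tail-free record `DataQ.inpRm · ρ`) THE RATIONAL MAJORANT RECORD: `Stage1Cells.DataQ.inpRm · ρ` with the closed-form tails at `S s`, `S̄ s` added to the
twenty-two tail fields, literally as in `inpT`. [cite: FitznerVanDerHofstad2017, notebook Percolation.nb cells 41–44 (transcript l.1131–1237)] -/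
def inpMajQ (E : DataQ) (P : Params) (ρ : Fin 10 → T) (y : StateQ) (s : Pt) (S Sb : Pt → Matrix (Fin 3) (Fin 3) ℚ) : Inputs :=
  let tv : List Piece → ℝ := fun l => ((tailValQ E P ρ y s (S s) (Sb s) l : ℚ) : ℝ)
  { E.inpRm P ρ y s with
    xiAbs := (E.inpRm P ρ y s).xiAbs + (tv Tail.xiOdd + tv Tail.xiEven)
    xiOdd := (E.inpRm P ρ y s).xiOdd + tv Tail.xiOdd
    xiEven := (E.inpRm P ρ y s).xiEven + tv Tail.xiEven
    xiEvenTail := (E.inpRm P ρ y s).xiEvenTail + tv Tail.xiEven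
    xiOddTail := (E.inpRm P ρ y s).xiOddTail + tv Tail.xiOdd
    xiDeltaAbs := (E.inpRm P ρ y s).xiDeltaAbs + (tv Tail.xiOddDelta + tv Tail.xiEvenDelta)
    xiOddDelta := (E.inpRm P ρ y s).xiOddDelta + tv Tail.xiOddDelta
    xiEvenDelta := (E.inpRm P ρ y s).xiEvenDelta + tv Tail.xiEvenDelta
    xiOddTailDelta := (E.inpRm P ρ y s).xiOddTailDelta + tv Tail.xiOddDelta
    xiEvenTailDelta := (E.inpRm P ρ y s).xiEvenTailDelta + tv Tail.xiEvenDelta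
    xiIotaAbs := (E.inpRm P ρ y s).xiIotaAbs + (tv Tail.xiIotaOdd + tv Tail.xiIotaEven)
    xiIotaOdd := (E.inpRm P ρ y s).xiIotaOdd + tv Tail.xiIotaOdd
    xiIotaEven := (E.inpRm P ρ y s).xiIotaEven + tv Tail.xiIotaEven
    xiIotaEvenTail := (E.inpRm P ρ y s).xiIotaEvenTail + tv Tail.xiIotaEven
    xiIotaDeltaEi := (E.inpRm P ρ y s).xiIotaDeltaEi + (tv Tail.xiIotaOddDeltaEi + tv Tail.xiIotaEvenDeltaEi)
    xiIotaOddDeltaEi := (E.inpRm P ρ y s).xiIotaOddDeltaEi + tv Tail.xiIotaOddDeltaEi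
    xiIotaEvenDeltaEi := (E.inpRm P ρ y s).xiIotaEvenDeltaEi + tv Tail.xiIotaEvenDeltaEi
    xiIotaEvenTailDeltaEi := (E.inpRm P ρ y s).xiIotaEvenTailDeltaEi + tv Tail.xiIotaEvenDeltaEi
    xiIotaDeltaZero := (E.inpRm P ρ y s).xiIotaDeltaZero
      + (tv Tail.xiIotaOddDeltaZero + tv Tail.xiIotaEvenDeltaZero)
    xiIotaOddDeltaZero := (E.inpRm P ρ y s).xiIotaOddDeltaZero + tv Tail.xiIotaOddDeltaZero
    xiIotaEvenDeltaZero := (E.inpRm P ρ y s).xiIotaEvenDeltaZero + tv Tail.xiIotaEvenDeltaZero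
    xiIotaEvenTailDeltaZero := (E.inpRm P ρ y s).xiIotaEvenTailDeltaZero + tv Tail.xiIotaEvenDeltaZero }

variable {D : Data ν} {E : DataQ} (h : D.RatModel E) (ρ : Fin 10 → T)
include h

/-- (slotted recipe: re-bound over `Stage1Cells.Rem · ρ`) the ingredients of a modelled frame are the casts of the rational ones. [cite: FitznerVanDerHofstad2017, notebook Percolation.nb cells 41–44 (transcript l.1131–1237)] -/
theorem ingr_ratCast_rem (s : Pt) (y : StateQ) : ingr ρ D s y.cast = (ingrQ E D.P ρ s y).cast := by
  have hv : ∀ v : Vec, evV ρ D s y.cast v = (Rat.castHom ℝ) ∘ evVQ E D.P ρ s y v :=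
    fun v => funext fun a => Data.evRm_ratCast h ρ s y (v a)
  have hm : ∀ Mx : Mat, evM ρ D s y.cast Mx = (evMQ E D.P ρ s y Mx).map (Rat.castHom ℝ) :=
    fun Mx => Matrix.ext fun a b => Data.evRm_ratCast h ρ s y (Mx a b)
  have h1 : (1 : Matrix (Fin 3) (Fin 3) ℝ) = (1 : Matrix (Fin 3) (Fin 3) ℚ).map (Rat.castHom ℝ) :=
    (Matrix.map_one _ (map_zero _) (map_one _)).symm
  show Ingr.mk _ _ _ _ _ = Ingr.mk _ _ _ _ _
  congr 1
  · funext t; cases t <;> exact hv _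
  · funext t; cases t <;> first | exact hm _ | exact h1
  · funext t; cases t <;> exact hv _
  · exact hm _
  · exact hm _

/-- (slotted recipe: re-bound over `Stage1Cells.Rem · ρ`) the tail value of a modelled frame under the cast closed-form reading is the cast of the rational one. [cite: FitznerVanDerHofstad2017, notebook Percolation.nb cells 41–44 (transcript l.1131–1237)] -/
theorem tailVal_ratCast_rem (y : StateQ) (s : Pt) (S Sb : Matrix (Fin 3) (Fin 3) ℚ) (l : List Piece) :
    tailVal ρ (Reading.closed (S.map (Rat.castHom ℝ)) (Sb.map (Rat.castHom ℝ))) D y.cast s l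
      = ((tailValQ E D.P ρ y s S Sb l : ℚ) : ℝ) := by
  unfold tailVal tailValQ; rw [ingr_ratCast_rem h ρ]; exact total_cast S Sb _ l

/-- (slotted recipe: re-bound over `Stage1Cells.Rem · ρ`) THE CAST LEMMA FOR THE MAJORANT RECORD. [cite: FitznerVanDerHofstad2017, notebook Percolation.nb cells 41–44 (transcript l.1131–1237)] -/
theorem inpMaj_ratCast_rem (y : StateQ) (s : Pt) (S Sb : Pt → Matrix (Fin 3) (Fin 3) ℚ) :
    inpMaj ρ (fun t => (S t).map (Rat.castHom ℝ)) (fun t => (Sb t).map (Rat.castHom ℝ)) D y.cast s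
      = inpMajQ E D.P ρ y s S Sb := by
  simp only [inpMaj, inpT, inpMajQ, tailVal_ratCast_rem h ρ, Data.inpRm_ratCast h ρ]

/-- (slotted recipe: re-bound over `Stage1Cells.Rem · ρ`) kernel form: the majorant record of a modelled frame is dominated by `N` if the rational one is. [cite: FitznerVanDerHofstad2017, notebook Percolation.nb cells 41–44 (transcript l.1131–1237)] -/
theorem inpMaj_dom_of_ratModel_rem {y : StateQ} {s : Pt} {S Sb : Pt → Matrix (Fin 3) (Fin 3) ℚ} {N : Inputs}
    (hN : (inpMajQ E D.P ρ y s S Sb).Dom N) :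
    (inpMaj ρ (fun t => (S t).map (Rat.castHom ℝ)) (fun t => (Sb t).map (Rat.castHom ℝ)) D y.cast s).Dom N := by
  rw [inpMaj_ratCast_rem h ρ]; exact hN

/-- (slotted recipe: re-bound over `Stage1Cells.Rem · ρ`) THE FULL CHAIN IN KERNEL FORM: the cell-44 record WITH ITS TAILS (series reading) of a modelled frame is dominated
by a record `N` as soon as the cells are `≥ 0` at the state, the two RATIONAL Neumann certificates hold at the point,
and the rational majorant record is dominated by `N` — the last three being closed rational facts. [cite: FitznerVanDerHofstad2017, notebook Percolation.nb cells 41–44 (transcript l.1131–1237)] -/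
theorem inpFull_dom_of_ratModel_rem {y : StateQ} {s : Pt} {S Sb : Pt → Matrix (Fin 3) (Fin 3) ℚ} {N : Inputs}
    (hev : ∀ e, 0 ≤ D.evRm ρ s y.cast e)
    (hS0 : ∀ i j, 0 ≤ S s i j) (hS : (1 - (ingrQ E D.P ρ s y).B * (ingrQ E D.P ρ s y).B) * S s = 1)
    (hSb0 : ∀ i j, 0 ≤ Sb s i j) (hSb : (1 - (ingrQ E D.P ρ s y).Bb * (ingrQ E D.P ρ s y).Bb) * Sb s = 1)
    (hN : (inpMajQ E D.P ρ y s S Sb).Dom N) : (inpFull ρ D y.cast s).Dom N := by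
  have hB : (ingr ρ D s y.cast).B = (ingrQ E D.P ρ s y).B.map (Rat.castHom ℝ) := by rw [ingr_ratCast_rem h ρ]; rfl
  have hBb : (ingr ρ D s y.cast).Bb = (ingrQ E D.P ρ s y).Bb.map (Rat.castHom ℝ) := by rw [ingr_ratCast_rem h ρ]; rfl
  refine (inpFull_dom_inpMaj_rem ρ hev (S := fun t => (S t).map (Rat.castHom ℝ))
    (Sb := fun t => (Sb t).map (Rat.castHom ℝ)) (nonneg_cast hS0) ?_ (nonneg_cast hSb0) ?_).trans
    (inpMaj_dom_of_ratModel_rem h ρ hN)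
  · show (1 - _ * _) * (S s).map (Rat.castHom ℝ) = 1
    rw [hB]; exact cert_cast hS
  · show (1 - _ * _) * (Sb s).map (Rat.castHom ℝ) = 1
    rw [hBb]; exact cert_cast hSb

/-- (slotted recipe: re-bound over `Stage1Cells.Rem · ρ`) … and so is the tail-free record `Data.inpRm ρ` (which `Stage1Eval` also gives directly). [cite: FitznerVanDerHofstad2017, notebook Percolation.nb cells 41–44 (transcript l.1131–1237)] -/
theorem inp_dom_of_ratModel_tails_rem {y : StateQ} {s : Pt} {S Sb : Pt → Matrix (Fin 3) (Fin 3) ℚ} {N : Inputs}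
    (hev : ∀ e, 0 ≤ D.evRm ρ s y.cast e)
    (hS0 : ∀ i j, 0 ≤ S s i j) (hS : (1 - (ingrQ E D.P ρ s y).B * (ingrQ E D.P ρ s y).B) * S s = 1)
    (hSb0 : ∀ i j, 0 ≤ Sb s i j) (hSb : (1 - (ingrQ E D.P ρ s y).Bb * (ingrQ E D.P ρ s y).Bb) * Sb s = 1)
    (hN : (inpMajQ E D.P ρ y s S Sb).Dom N) : (D.inpRm ρ y.cast s).Dom N :=
  (inp_dom_inpFull_rem ρ hev).trans (inpFull_dom_of_ratModel_rem h ρ hev hS0 hS hSb0 hSb hN)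

end RatFrame

/-! ## Literal reproduction: at the record reads `ρ := printSlots P` this layer IS `Stage1Tails.Rec` -/

section Print

variable {ν : Type*}

/-- at the record reads, `h^S.AiotaNonRepᵀ` of the slotted recipe is the one of the cells of record. [cite: FitznerVanDerHofstad2017, notebook Percolation.nb cells 41–44 (transcript l.1131–1237); NoBLE17-I §5.3.3 (printed remainder reads)] -/
@[simp] theorem hSAtNR_print (P : Params) : hSAtNR P (printSlots P) = Stage1Tails.Rec.hSAtNR P := rfl

/-- at the record reads, `H₃.P^E + AiotaNonRep.h^E` of the slotted recipe is the one of the cells of record. [cite: FitznerVanDerHofstad2017, notebook Percolation.nb cells 41–44 (transcript l.1131–1237); NoBLE17-I §5.3.3 (printed remainder reads)] -/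
@[simp] theorem H3PEAhE_print (P : Params) : H3PEAhE P (printSlots P) = Stage1Tails.Rec.H3PEAhE P := rfl

/-- at the record reads, `H₂.P^E + AiotaNonRep.h^E` of the slotted recipe is the one of the cells of record. [cite: FitznerVanDerHofstad2017, notebook Percolation.nb cells 41–44 (transcript l.1131–1237); NoBLE17-I §5.3.3 (printed remainder reads)] -/
@[simp] theorem H2PEAhE_print (P : Params) : H2PEAhE P (printSlots P) = Stage1Tails.Rec.H2PEAhE P := rfl

/-- at the record reads, `C₂.B̄ + B.C₁` of the slotted recipe is the one of the cells of record. [cite: FitznerVanDerHofstad2017, notebook Percolation.nb cells 41–44 (transcript l.1131–1237); NoBLE17-I §5.3.3 (printed remainder reads)] -/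
@[simp] theorem C2BbarBC1_print (P : Params) : C2BbarBC1 P (printSlots P) = Stage1Tails.Rec.C2BbarBC1 P := rfl

/-- at the record reads, vectors of cells evaluate as in the frame of record. [cite: FitznerVanDerHofstad2017, notebook Percolation.nb cells 41–44 (transcript l.1131–1237); NoBLE17-I §5.3.3 (printed remainder reads)] -/
@[simp] theorem evV_print (D : Data ν) (s : Pt) (y : State) (v : Vec) :
    evV (printSlots D.P) D s y v = Stage1Tails.evV D s y v := funext fun a => D.evRm_print s y (v a)

/-- at the record reads, matrices of cells evaluate as in the frame of record. [cite: FitznerVanDerHofstad2017, notebook Percolation.nb cells 41–44 (transcript l.1131–1237); NoBLE17-I §5.3.3 (printed remainder reads)] -/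
@[simp] theorem evM_print (D : Data ν) (s : Pt) (y : State) (Mx : Mat) :
    evM (printSlots D.P) D s y Mx = Stage1Tails.evM D s y Mx := Matrix.ext fun a b => D.evRm_print s y (Mx a b)

/-- LITERAL REPRODUCTION (ingredients): at the record reads the ingredients of the slotted recipe ARE those of the
cells of record (`Stage1Tails.Rec.ingr`). [cite: FitznerVanDerHofstad2017, notebook Percolation.nb cells 41–44 (transcript l.1131–1237); NoBLE17-I §5.3.3 (printed remainder reads)] -/
theorem ingr_print (D : Data ν) (s : Pt) (y : State) : ingr (printSlots D.P) D s y = Stage1Tails.Rec.ingr D s y := by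
  show Ingr.mk _ _ _ _ _ = Ingr.mk _ _ _ _ _
  congr 1

/-- at the record reads, the tail values of the slotted recipe are those of the cells of record. [cite: FitznerVanDerHofstad2017, notebook Percolation.nb cells 41–44 (transcript l.1131–1237); NoBLE17-I §5.3.3 (printed remainder reads)] -/
theorem tailVal_print (Φ : Reading (Fin 3)) (D : Data ν) (y : State) (s : Pt) (l : List Piece) :
    tailVal (printSlots D.P) Φ D y s l = Stage1Tails.Rec.tailVal Φ D y s l := by
  unfold tailVal Stage1Tails.Rec.tailVal; rw [ingr_print]

/-- LITERAL REPRODUCTION (cell 44 with tails read by `Φ`): at the record reads the slotted record IS the record of the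
cells of record (`Stage1Tails.Rec.inpT`). [cite: FitznerVanDerHofstad2017, notebook Percolation.nb cells 41–44 (transcript l.1131–1237); NoBLE17-I §5.3.3 (printed remainder reads)] -/
theorem inpT_print (Φ : Pt → Reading (Fin 3)) (D : Data ν) (y : State) (s : Pt) :
    inpT (printSlots D.P) Φ D y s = Stage1Tails.Rec.inpT Φ D y s := by
  simp only [inpT, Stage1Tails.Rec.inpT, tailVal_print, Data.inpRm_print]

/-- LITERAL REPRODUCTION (cell 44 with the series tails). [cite: FitznerVanDerHofstad2017, notebook Percolation.nb cells 41–44 (transcript l.1131–1237); NoBLE17-I §5.3.3 (printed remainder reads)] -/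
theorem inpFull_print (D : Data ν) (y : State) (s : Pt) :
    inpFull (printSlots D.P) D y s = Stage1Tails.Rec.inpFull D y s := inpT_print _ D y s

/-- LITERAL REPRODUCTION (closed-form majorant record). [cite: FitznerVanDerHofstad2017, notebook Percolation.nb cells 41–44 (transcript l.1131–1237); NoBLE17-I §5.3.3 (printed remainder reads)] -/
theorem inpMaj_print (S Sb : Pt → Matrix (Fin 3) (Fin 3) ℝ) (D : Data ν) (y : State) (s : Pt) :
    inpMaj (printSlots D.P) S Sb D y s = Stage1Tails.Rec.inpMaj S Sb D y s := inpT_print _ D y s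

/-- at the record reads, rational vectors of cells evaluate as in `Stage1TailsEval`. [cite: FitznerVanDerHofstad2017, notebook Percolation.nb cells 41–44 (transcript l.1131–1237); NoBLE17-I §5.3.3 (printed remainder reads)] -/
@[simp] theorem evVQ_print (E : DataQ) (P : Params) (s : Pt) (y : StateQ) (v : Vec) :
    evVQ E P (printSlots P) s y v = Stage1Tails.evVQ E P s y v := funext fun a => E.evRm_print P s y (v a)

/-- at the record reads, rational matrices of cells evaluate as in `Stage1TailsEval`. [cite: FitznerVanDerHofstad2017, notebook Percolation.nb cells 41–44 (transcript l.1131–1237); NoBLE17-I §5.3.3 (printed remainder reads)] -/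
@[simp] theorem evMQ_print (E : DataQ) (P : Params) (s : Pt) (y : StateQ) (Mx : Mat) :
    evMQ E P (printSlots P) s y Mx = Stage1Tails.evMQ E P s y Mx := Matrix.ext fun a b => E.evRm_print P s y (Mx a b)

/-- LITERAL REPRODUCTION (rational ingredients): at the record reads `Rem.ingrQ` IS `Stage1Tails.Rec.ingrQ`. [cite: FitznerVanDerHofstad2017, notebook Percolation.nb cells 41–44 (transcript l.1131–1237); NoBLE17-I §5.3.3 (printed remainder reads)] -/
theorem ingrQ_print (E : DataQ) (P : Params) (s : Pt) (y : StateQ) :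
    ingrQ E P (printSlots P) s y = Stage1Tails.Rec.ingrQ E P s y := by
  show IngrQ.mk _ _ _ _ _ = IngrQ.mk _ _ _ _ _
  congr 1

/-- at the record reads, the rational tail values of the slotted recipe are those of the cells of record. [cite: FitznerVanDerHofstad2017, notebook Percolation.nb cells 41–44 (transcript l.1131–1237); NoBLE17-I §5.3.3 (printed remainder reads)] -/
theorem tailValQ_print (E : DataQ) (P : Params) (y : StateQ) (s : Pt) (S Sb : Matrix (Fin 3) (Fin 3) ℚ) (l : List Piece) :
    tailValQ E P (printSlots P) y s S Sb l = Stage1Tails.Rec.tailValQ E P y s S Sb l := by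
  unfold tailValQ Stage1Tails.Rec.tailValQ; rw [ingrQ_print]

/-- LITERAL REPRODUCTION (rational majorant record): at the record reads `Rem.inpMajQ E P (printSlots P)` IS
`Stage1Tails.Rec.inpMajQ E P` — so `MeanFieldD11Stage1TailsEvalRec` is an instance of the evaluation pattern over this
file. [cite: FitznerVanDerHofstad2017, notebook Percolation.nb cells 41–44 (transcript l.1131–1237); NoBLE17-I §5.3.3 (printed remainder reads)] -/
theorem inpMajQ_print (E : DataQ) (P : Params) (y : StateQ) (s : Pt) (S Sb : Pt → Matrix (Fin 3) (Fin 3) ℚ) :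
    inpMajQ E P (printSlots P) y s S Sb = Stage1Tails.Rec.inpMajQ E P y s S Sb := by
  simp only [inpMajQ, Stage1Tails.Rec.inpMajQ, tailValQ_print, DataQ.inpRm_print]

end Print

end Stage1Tails.Rem
end Literature.Probability.FitznerVanDerHofstad2017
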